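import Literature.AlgebraicGeometry.Resolution.Lipman1969IntersectionTheory
import Literature.AlgebraicGeometry.Resolution.Lipman1969RationalContractionRegime
import Literature.AlgebraicGeometry.Resolution.ExceptionalCurvePoints
import Literature.AlgebraicGeometry.Resolution.DivisorialPartLemmas
import HarnessLib

/-!
# Crux `NoZenoR` (stmt-ResolutionOfSingularities-19943), β layer, `stub_L1wCoreF` descent brick for BC-4b:
# THE SYMMETRIC NUMERICS — criterion (M) passes from a reduced exceptional curve to its conjugate components

Route `ResolutionOfSingularities/HomologicalConductor`, crux chain W4.4.  OURS (cell res-hironaka, seat res-L0-w44-stub-2,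
(L1)-PREP v4 §2 «proof of record», planner (ρ43e)/(ρ48)); AI-written, weaker than expert review; nothing here is a
statement of the manuscript under review (Hironaka 2017).  Def-free, FACT-PARAMETRIC (`(h131b : Lipman1969_13_1_b_rat)`,
`(h131d : Lipman1969_13_1_d_rat)` explicit, res-L1-type-o5's F-97 `Lipman1969IntersectionTheory`), `--supports 19943 --as helper`.

Let `π : X → Spec S` be a desingularization of a two-dimensional normal Noetherian local domain with a RATIONAL singularity,
and `F` a finite set of (generic points of) integral exceptional curves `C_ζ`, `ζ ∈ F`, with ideal sheaves
`𝓘_ζ = primeDivisorIdeal ζ`; put `P := ∏_{ζ ∈ F} 𝓘_ζ` (the reduced curve `Ê = Σ C_ζ`) and, in Lipman's `h⁰`-lengths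
(`h0`, `χ = h⁰` in the rational regime), `β(𝓘, 𝓙) := h⁰(𝓘) + h⁰(𝓙) − h⁰(𝓘𝓙)` (`= (E·F)`, Prop. (13.1) d)).  Then:

* `beta_comm` — `β` is symmetric; `beta_prod_eq_sum` — `β(∏_G 𝓘, ∏_F 𝓘) = Σ_{ζ ∈ F} β(∏_G 𝓘, 𝓘_ζ)` ((13.1) b));
* `beta_nonneg_of_ne` — `β(𝓘_ζ, 𝓘_ξ) ≥ 0` for `ζ ≠ ξ` ((13.1) d) + c): it is `([C_ξ]·C_ζ) ≥ 0`, tree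
  `excCurveDegree_nonneg_of_isEffective`);
* `two_mul_h0_prod_add_cross_eq` — `2·h⁰(P) + Σ_{ζ ≠ ξ} β(𝓘_ζ, 𝓘_ξ) = 2·Σ_ζ h⁰(𝓘_ζ)` (i.e. `χ(Ê) = Σ χ(C_ζ) − Σ_{ζ<ξ} (C_ζ·C_ξ)`);
* `beta_prod_prod_eq` — `β(P, P) = Σ_ζ β(𝓘_ζ, 𝓘_ζ) + Σ_{ζ ≠ ξ} β(𝓘_ζ, 𝓘_ξ)` (bilinearity);
* **`sum_beta_self_lt`** — if `(M)` holds for `Ê`, i.e. `3·h⁰(P) < h⁰(P²)`, then `Σ_ζ β(𝓘_ζ, 𝓘_ζ) < −Σ_ζ h⁰(𝓘_ζ)`;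
* **`three_mul_h0_lt_of_symmetric`** — if moreover ALL the `C_ζ` have the same `h⁰(𝓘_ζ)` and the same `h⁰(𝓘_ζ²)` (e.g. they
  are permuted transitively by automorphisms of `X` over automorphisms of `S`), then EVERY `C_ζ` satisfies (M):
  `3·h0 π 𝓘_ζ < h0 π (𝓘_ζ²)`.

This is the arithmetic heart of the Galois ascent of minimality (BC-4b): with `P = σ*𝓘_E`
(`…NoZenoExcCurvesUnramifiedBaseChange.comap_primeDivisorIdeal_eq_prod`), `h⁰(P) = h⁰(𝓘_E)`, `h⁰(P²) = h⁰(𝓘_E²)`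
(`…NoZenoH0BaseChange.h0_comap_eq`, `comap_pow`) and `Lipman1969_27_3_rat` on both floors.  Without the symmetry the
conclusion fails ((F-bc) retraction, PREP v4 §0: `(C₁+C₂)² = −4` with `C_j² = −3`).  References: J. Lipman, Publ. Math.
IHÉS 36 (1969) §13 Prop. (13.1) p. 223, §27 Cor. (27.3) p. 277 [`Lipman1969`].
-/

noncomputable section

-- single-problem summit: the doubled namespace component `ResolutionOfSingularities` is forced
set_option linter.dupNamespace false

namespace Summit.ResolutionOfSingularities.ResolutionOfSingularities.Theorems.NoZeno.ExcCount

open CategoryTheory AlgebraicGeometry TopologicalSpace IsLocalRing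
open Literature.AlgebraicGeometry.Resolution Literature.AlgebraicGeometry.Motives

universe u

section Numerics

variable {S : Type u} [CommRing S] [IsNoetherianRing S] [IsLocalRing S] [IsDomain S] [IsIntegrallyClosed S]
  {X : Scheme.{u}} [IsIntegral X] [IsLocallyNoetherian X] (π : X ⟶ Spec (.of S))

/-! ## §1 The pairing `β(𝓘, 𝓙) = h⁰(𝓘) + h⁰(𝓙) − h⁰(𝓘𝓙)` on products of prime divisor ideals -/

omit [IsNoetherianRing S] [IsLocalRing S] [IsDomain S] [IsIntegrallyClosed S] [IsIntegral X]
  [IsLocallyNoetherian X] in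
/-- `β` is symmetric: `h⁰(𝓘𝓙) = h⁰(𝓙𝓘)`. [folklore] -/
theorem beta_comm (𝓘 𝓙 : X.IdealSheafData) :
    ((h0 π 𝓘).toNat : ℤ) + ((h0 π 𝓙).toNat : ℤ) - ((h0 π (𝓘 * 𝓙)).toNat : ℤ) =
      ((h0 π 𝓙).toNat : ℤ) + ((h0 π 𝓘).toNat : ℤ) - ((h0 π (𝓙 * 𝓘)).toNat : ℤ) := by
  rw [mul_comm 𝓘 𝓙]; ring

variable (h2 : ringKrullDim S = 2) (hS : HasRationalSingularity S) (hπ : IsResolution π)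
  (h131b : Lipman1969_13_1_b_rat.{u}) (h131d : Lipman1969_13_1_d_rat.{u})

omit [IsIntegral X] [IsLocallyNoetherian X] in
include h2 hS hπ h131b in
/-- **Additivity of `β` in the second variable over a product of exceptional prime divisor ideals** ((13.1) b), iterated):
`β(∏_G 𝓘, ∏_F 𝓘) = Σ_{ζ ∈ F} β(∏_G 𝓘, 𝓘_ζ)` for non-empty finite sets `G`, `F` of integral exceptional curves.
[cite: Lipman1969, Proposition (13.1) b) (p. 223)] -/
theorem beta_prod_eq_sum (G : Finset X) (hG : G.Nonempty) (hGe : ∀ ζ ∈ G, ζ ∈ excCurvePoints π)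
    (F : Finset X) (hF : F.Nonempty) (hFe : ∀ ζ ∈ F, ζ ∈ excCurvePoints π) :
    ((h0 π (∏ ζ ∈ G, primeDivisorIdeal ζ)).toNat : ℤ) + ((h0 π (∏ ζ ∈ F, primeDivisorIdeal ζ)).toNat : ℤ) -
        ((h0 π ((∏ ζ ∈ G, primeDivisorIdeal ζ) * ∏ ζ ∈ F, primeDivisorIdeal ζ)).toNat : ℤ) =
      ∑ ζ ∈ F, (((h0 π (∏ ξ ∈ G, primeDivisorIdeal ξ)).toNat : ℤ) + ((h0 π (primeDivisorIdeal ζ)).toNat : ℤ) -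
        ((h0 π ((∏ ξ ∈ G, primeDivisorIdeal ξ) * primeDivisorIdeal ζ)).toNat : ℤ)) := by
  induction hF using Finset.Nonempty.cons_induction with
  | singleton a => simp
  | cons a s has hs ih =>
    rw [Finset.prod_cons, Finset.sum_cons, ← ih (fun ζ hζ => hFe ζ (Finset.mem_cons_of_mem hζ))]
    -- (13.1) b) with `𝓘 = ∏_G`, `𝓙 = 𝓘_a`, `𝓚 = ∏_s`
    have hb := h131b S h2 hS X π hπ G.val {a} s.val (by simpa using hG.ne_empty) (by simp)
      (by simpa using hs.ne_empty) (fun ζ hζ => hGe ζ hζ) (fun ζ hζ => by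
        rw [Multiset.mem_singleton] at hζ; subst hζ; exact hFe _ (Finset.mem_cons_self _ _))
      (fun ζ hζ => hFe ζ (Finset.mem_cons_of_mem hζ))
    simp only [Multiset.map_singleton, Multiset.prod_singleton] at hb
    have e1 : (Multiset.map primeDivisorIdeal G.val).prod = ∏ ζ ∈ G, primeDivisorIdeal ζ := rfl
    have e2 : (Multiset.map primeDivisorIdeal s.val).prod = ∏ ζ ∈ s, primeDivisorIdeal ζ := rfl
    simp only [e1, e2] at hb
    rw [mul_assoc] at hb
    exact hb

include h2 hS hπ h131d in
/-- **`β(𝓘_ζ, 𝓘_ξ) ≥ 0` for distinct integral exceptional curves** ((13.1) d): `β(𝓘_ζ, 𝓘_ξ) = ([C_ξ]·C_ζ)`, and (13.1) c) /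
tree `excCurveDegree_nonneg_of_isEffective`: the effective divisor `[C_ξ]` avoids `ζ`). [cite: Lipman1969, Proposition (13.1) c), d) (p. 223)] -/
theorem beta_nonneg_of_ne {ζ ξ : X} (hζ : ζ ∈ excCurvePoints π) (hξ : ξ ∈ excCurvePoints π) (hne : ζ ≠ ξ) :
    0 ≤ ((h0 π (primeDivisorIdeal ζ)).toNat : ℤ) + ((h0 π (primeDivisorIdeal ξ)).toNat : ℤ) -
      ((h0 π (primeDivisorIdeal ζ * primeDivisorIdeal ξ)).toNat : ℤ) := by
  haveI : IsProper π := hπ.isProper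
  have hcoξ : Order.coheight ξ = 1 := hπ.coheight_eq_one_of_mem_excCurvePoints h2 hξ
  have hcoζ : Order.coheight ζ = 1 := hπ.coheight_eq_one_of_mem_excCurvePoints h2 hζ
  have hF : IsEffectiveCartier (primeDivisorIdeal ξ) :=
    isEffectiveCartier_primeDivisorIdeal_of_isRegular hπ.isRegular hcoξ
  have hd := h131d S h2 hS X π hπ ζ hζ ξ hξ hF
  rw [mul_comm] at hd
  rw [← hd]
  refine excCurveDegree_nonneg_of_isEffective π hζ (CartierDivisor.isEffective_ofIsEffectiveCartier _ hF) ?_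
  rw [CartierDivisor.avoids_ofIsEffectiveCartier_iff, mem_support_primeDivisorIdeal_iff]
  exact not_specializes_of_coheight_eq_one hcoξ hcoζ hne.symm

omit [IsIntegral X] [IsLocallyNoetherian X] in
include h2 hS hπ h131b in
/-- **`2·h⁰(∏_F 𝓘) + Σ_{ζ ≠ ξ} β(𝓘_ζ, 𝓘_ξ) = 2·Σ_ζ h⁰(𝓘_ζ)`** — Lipman's `χ(Ê) = Σ_ζ χ(C_ζ) − Σ_{ζ<ξ} (C_ζ·C_ξ)` for the
reduced curve `Ê = Σ_{ζ ∈ F} C_ζ`, doubled to avoid halving the symmetric cross sum (induction on `F` with (13.1) b)).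
[cite: Lipman1969, Proposition (13.1) b), d) (p. 223)] -/
theorem two_mul_h0_prod_add_cross_eq [DecidableEq X] (F : Finset X) (hF : F.Nonempty) (hFe : ∀ ζ ∈ F, ζ ∈ excCurvePoints π) :
    2 * ((h0 π (∏ ζ ∈ F, primeDivisorIdeal ζ)).toNat : ℤ) +
        ∑ ζ ∈ F, ∑ ξ ∈ F.erase ζ, (((h0 π (primeDivisorIdeal ζ)).toNat : ℤ) +
          ((h0 π (primeDivisorIdeal ξ)).toNat : ℤ) - ((h0 π (primeDivisorIdeal ζ * primeDivisorIdeal ξ)).toNat : ℤ)) =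
      2 * ∑ ζ ∈ F, ((h0 π (primeDivisorIdeal ζ)).toNat : ℤ) := by
  induction hF using Finset.Nonempty.cons_induction with
  | singleton a => simp
  | cons a s has hs ih =>
    have hse : ∀ ζ ∈ s, ζ ∈ excCurvePoints π := fun ζ hζ => hFe ζ (Finset.mem_cons_of_mem hζ)
    have hae : a ∈ excCurvePoints π := hFe a (Finset.mem_cons_self _ _)
    -- `β(𝓘_a, ∏_s) = Σ_{ξ ∈ s} β(𝓘_a, 𝓘_ξ)`
    have hadd := beta_prod_eq_sum π h2 hS hπ h131b {a} (Finset.singleton_nonempty a)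
      (fun ζ hζ => by rw [Finset.mem_singleton] at hζ; subst hζ; exact hae) s hs hse
    simp only [Finset.prod_singleton] at hadd
    -- split the cross sum over `cons a s`
    have hcross : ∑ ζ ∈ Finset.cons a s has, ∑ ξ ∈ (Finset.cons a s has).erase ζ,
          (((h0 π (primeDivisorIdeal ζ)).toNat : ℤ) + ((h0 π (primeDivisorIdeal ξ)).toNat : ℤ) -
            ((h0 π (primeDivisorIdeal ζ * primeDivisorIdeal ξ)).toNat : ℤ)) =
        2 * ∑ ξ ∈ s, (((h0 π (primeDivisorIdeal a)).toNat : ℤ) + ((h0 π (primeDivisorIdeal ξ)).toNat : ℤ) -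
            ((h0 π (primeDivisorIdeal a * primeDivisorIdeal ξ)).toNat : ℤ)) +
          ∑ ζ ∈ s, ∑ ξ ∈ s.erase ζ, (((h0 π (primeDivisorIdeal ζ)).toNat : ℤ) +
            ((h0 π (primeDivisorIdeal ξ)).toNat : ℤ) -
              ((h0 π (primeDivisorIdeal ζ * primeDivisorIdeal ξ)).toNat : ℤ)) := by
      rw [Finset.sum_cons]
      have h1 : (Finset.cons a s has).erase a = s := by
        rw [Finset.cons_eq_insert, Finset.erase_insert has]
      rw [h1]
      have h2' : ∀ ζ ∈ s, (Finset.cons a s has).erase ζ = Finset.cons a (s.erase ζ)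
          (fun h => has (Finset.mem_of_mem_erase h)) := by
        intro ζ hζ
        have hne : a ≠ ζ := fun h => has (h ▸ hζ)
        rw [Finset.cons_eq_insert, Finset.cons_eq_insert, Finset.erase_insert_of_ne hne]
      have h2'' : ∑ ζ ∈ s, ∑ ξ ∈ (Finset.cons a s has).erase ζ,
            (((h0 π (primeDivisorIdeal ζ)).toNat : ℤ) + ((h0 π (primeDivisorIdeal ξ)).toNat : ℤ) -
              ((h0 π (primeDivisorIdeal ζ * primeDivisorIdeal ξ)).toNat : ℤ)) =
          ∑ ζ ∈ s, ((((h0 π (primeDivisorIdeal ζ)).toNat : ℤ) + ((h0 π (primeDivisorIdeal a)).toNat : ℤ) -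
              ((h0 π (primeDivisorIdeal ζ * primeDivisorIdeal a)).toNat : ℤ)) +
            ∑ ξ ∈ s.erase ζ, (((h0 π (primeDivisorIdeal ζ)).toNat : ℤ) +
              ((h0 π (primeDivisorIdeal ξ)).toNat : ℤ) -
                ((h0 π (primeDivisorIdeal ζ * primeDivisorIdeal ξ)).toNat : ℤ))) :=
        Finset.sum_congr rfl fun ζ hζ => by rw [h2' ζ hζ, Finset.sum_cons]
      rw [h2'', Finset.sum_add_distrib]
      have h3 : ∑ ζ ∈ s, (((h0 π (primeDivisorIdeal ζ)).toNat : ℤ) + ((h0 π (primeDivisorIdeal a)).toNat : ℤ) -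
            ((h0 π (primeDivisorIdeal ζ * primeDivisorIdeal a)).toNat : ℤ)) =
          ∑ ζ ∈ s, (((h0 π (primeDivisorIdeal a)).toNat : ℤ) + ((h0 π (primeDivisorIdeal ζ)).toNat : ℤ) -
            ((h0 π (primeDivisorIdeal a * primeDivisorIdeal ζ)).toNat : ℤ)) :=
        Finset.sum_congr rfl fun ζ _ => beta_comm π _ _
      rw [h3]
      ring
    rw [hcross, Finset.prod_cons, Finset.sum_cons]
    have hih := ih hse
    -- `h⁰(𝓘_a · ∏_s) = h⁰(𝓘_a) + h⁰(∏_s) − β(𝓘_a, ∏_s)`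
    linear_combination hih - 2 * hadd

omit [IsIntegral X] [IsLocallyNoetherian X] in
include h2 hS hπ h131b in
/-- **Bilinearity: `β(P, P) = Σ_ζ β(𝓘_ζ, 𝓘_ζ) + Σ_{ζ ≠ ξ} β(𝓘_ζ, 𝓘_ξ)`** for `P = ∏_{ζ ∈ F} 𝓘_ζ`
(`(Ê·Ê) = Σ (C_ζ²) + Σ_{ζ≠ξ} (C_ζ·C_ξ)`). [cite: Lipman1969, Proposition (13.1) b) (p. 223)] -/
theorem beta_prod_prod_eq [DecidableEq X] (F : Finset X) (hF : F.Nonempty) (hFe : ∀ ζ ∈ F, ζ ∈ excCurvePoints π) :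
    ((h0 π (∏ ζ ∈ F, primeDivisorIdeal ζ)).toNat : ℤ) + ((h0 π (∏ ζ ∈ F, primeDivisorIdeal ζ)).toNat : ℤ) -
        ((h0 π ((∏ ζ ∈ F, primeDivisorIdeal ζ) * ∏ ζ ∈ F, primeDivisorIdeal ζ)).toNat : ℤ) =
      ∑ ζ ∈ F, (((h0 π (primeDivisorIdeal ζ)).toNat : ℤ) + ((h0 π (primeDivisorIdeal ζ)).toNat : ℤ) -
          ((h0 π (primeDivisorIdeal ζ * primeDivisorIdeal ζ)).toNat : ℤ)) +
        ∑ ζ ∈ F, ∑ ξ ∈ F.erase ζ, (((h0 π (primeDivisorIdeal ζ)).toNat : ℤ) +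
          ((h0 π (primeDivisorIdeal ξ)).toNat : ℤ) - ((h0 π (primeDivisorIdeal ζ * primeDivisorIdeal ξ)).toNat : ℤ)) := by
  -- first expand in the second variable: `β(P, P) = Σ_ζ β(P, 𝓘_ζ)`
  rw [beta_prod_eq_sum π h2 hS hπ h131b F hF hFe F hF hFe, ← Finset.sum_add_distrib]
  refine Finset.sum_congr rfl fun ζ hζ => ?_
  -- then `β(P, 𝓘_ζ) = β(𝓘_ζ, P) = Σ_ξ β(𝓘_ζ, 𝓘_ξ)`, and split off the diagonal term
  have hsymm := beta_comm π (∏ ξ ∈ F, primeDivisorIdeal ξ) (primeDivisorIdeal ζ)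
  rw [hsymm]
  have hadd := beta_prod_eq_sum π h2 hS hπ h131b {ζ} (Finset.singleton_nonempty ζ)
    (fun ξ hξ => by rw [Finset.mem_singleton] at hξ; subst hξ; exact hFe _ hζ) F hF hFe
  simp only [Finset.prod_singleton] at hadd
  rw [hadd, ← Finset.add_sum_erase F _ hζ]

include h2 hS hπ h131b h131d in
/-- **If the reduced curve `Ê = Σ_{ζ ∈ F} C_ζ` satisfies (M), the (negative) self-pairings of its components outweigh their
`h⁰`'s in total**: `3·h⁰(P) < h⁰(P²)` implies `Σ_ζ β(𝓘_ζ, 𝓘_ζ) < −Σ_ζ h⁰(𝓘_ζ)` — from `β(P,P) = Σ β(𝓘_ζ,𝓘_ζ) + U`,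
`2h⁰(P) + U = 2Σ h⁰(𝓘_ζ)` and `U ≥ 0` (`U` the cross sum). [cite: Lipman1969, Proposition (13.1) (p. 223) and Corollary (27.3) (p. 277)] -/
theorem sum_beta_self_lt (F : Finset X) (hF : F.Nonempty) (hFe : ∀ ζ ∈ F, ζ ∈ excCurvePoints π)
    (hM : 3 * ((h0 π (∏ ζ ∈ F, primeDivisorIdeal ζ)).toNat : ℤ) <
      ((h0 π ((∏ ζ ∈ F, primeDivisorIdeal ζ) ^ 2)).toNat : ℤ)) :
    ∑ ζ ∈ F, (((h0 π (primeDivisorIdeal ζ)).toNat : ℤ) + ((h0 π (primeDivisorIdeal ζ)).toNat : ℤ) -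
        ((h0 π (primeDivisorIdeal ζ * primeDivisorIdeal ζ)).toNat : ℤ)) <
      -∑ ζ ∈ F, ((h0 π (primeDivisorIdeal ζ)).toNat : ℤ) := by
  classical
  have hT := beta_prod_prod_eq π h2 hS hπ h131b F hF hFe
  have hU := two_mul_h0_prod_add_cross_eq π h2 hS hπ h131b F hF hFe
  have hU0 : 0 ≤ ∑ ζ ∈ F, ∑ ξ ∈ F.erase ζ, (((h0 π (primeDivisorIdeal ζ)).toNat : ℤ) +
      ((h0 π (primeDivisorIdeal ξ)).toNat : ℤ) - ((h0 π (primeDivisorIdeal ζ * primeDivisorIdeal ξ)).toNat : ℤ)) :=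
    Finset.sum_nonneg fun ζ hζ => Finset.sum_nonneg fun ξ hξ =>
      beta_nonneg_of_ne π h2 hS hπ h131d (hFe ζ hζ) (hFe ξ (Finset.mem_of_mem_erase hξ))
        (Finset.ne_of_mem_erase hξ).symm
  rw [pow_two] at hM
  linarith

omit [IsNoetherianRing S] [IsLocalRing S] [IsDomain S] [IsIntegrallyClosed S] [IsIntegral X]
  [IsLocallyNoetherian X] in
/-- A point lies in `supp(∏_{ζ ∈ F} 𝓘_ζ)` iff it lies on one of the curves `cl{ζ}`. [folklore] -/
theorem mem_support_finset_prod_primeDivisorIdeal_iff (F : Finset X) (x : X) :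
    x ∈ ((∏ ζ ∈ F, primeDivisorIdeal ζ).support : Set X) ↔ ∃ ζ ∈ F, ζ ⤳ x := by
  classical
  induction F using Finset.induction_on with
  | empty =>
    simp only [Finset.prod_empty, Finset.notMem_empty, false_and, exists_false, iff_false]
    change x ∉ ((⊤ : X.IdealSheafData).support : Set X)
    rw [Scheme.IdealSheafData.support_top]
    exact id
  | insert a s ha ih =>
    rw [Finset.prod_insert ha, Scheme.IdealSheafData.support_mul]
    change x ∈ ((primeDivisorIdeal a).support : Set X) ∪ ((∏ ζ ∈ s, primeDivisorIdeal ζ).support : Set X) ↔ _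
    rw [Set.mem_union, SetLike.mem_coe, mem_support_primeDivisorIdeal_iff, ih]
    simp

include h2 hS hπ h131b h131d in
/-- **THE SYMMETRIC NUMERICS (BC-4b core).**  If the reduced exceptional curve `Ê = Σ_{ζ ∈ F} C_ζ` satisfies criterion (M)
in `h⁰`-lengths, `3·h⁰(𝓘_Ê) < h⁰(𝓘_Ê²)` with `𝓘_Ê = ∏_F 𝓘_ζ`, and all its components have the SAME `h⁰(𝓘_ζ)` and the same
`h⁰(𝓘_ζ²)` (e.g. because a group of automorphisms of the `S`-scheme `X` — over automorphisms of `S` — permutes them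
transitively), then EVERY component satisfies (M): `3·h0 π 𝓘_ζ < h0 π (𝓘_ζ²)`.  (By symmetry `Σ_ζ β(𝓘_ζ,𝓘_ζ) = r·β₀` and
`Σ h⁰ = r·h⁰₀`, so `sum_beta_self_lt` gives `β₀ < −h⁰₀`, i.e. `3h⁰₀ < h⁰(𝓘₀²)`.)  The numbers are those of
`Lipman1969_27_3_rat` (`IsMinimalResolution π ↔ ∀ η, 3·h0 π 𝓘_η < h0 π (𝓘_η²)`). [cite: Lipman1969, Corollary (27.3) (p. 277)] -/
theorem three_mul_h0_lt_of_symmetric (F : Finset X) (hFe : ∀ ζ ∈ F, ζ ∈ excCurvePoints π) {ζ₀ : X} (hζ₀ : ζ₀ ∈ F)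
    (ha : ∀ ζ ∈ F, h0 π (primeDivisorIdeal ζ) = h0 π (primeDivisorIdeal ζ₀))
    (hb : ∀ ζ ∈ F, h0 π (primeDivisorIdeal ζ ^ 2) = h0 π (primeDivisorIdeal ζ₀ ^ 2))
    (hM : 3 * h0 π (∏ ζ ∈ F, primeDivisorIdeal ζ) < h0 π ((∏ ζ ∈ F, primeDivisorIdeal ζ) ^ 2)) :
    3 * h0 π (primeDivisorIdeal ζ₀) < h0 π (primeDivisorIdeal ζ₀ ^ 2) := by
  classical
  haveI : IsProper π := hπ.isProper
  have hF : F.Nonempty := ⟨ζ₀, hζ₀⟩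
  -- finiteness of the lengths involved
  have hfin1 : h0 π (primeDivisorIdeal ζ₀) ≠ ⊤ := by
    simpa using h0_pow_primeDivisorIdeal_ne_top π (hFe ζ₀ hζ₀) (n := 1) one_ne_zero
  have hfin2 : h0 π (primeDivisorIdeal ζ₀ ^ 2) ≠ ⊤ :=
    h0_pow_primeDivisorIdeal_ne_top π (hFe ζ₀ hζ₀) (n := 2) two_ne_zero
  have hfinP : h0 π (∏ ζ ∈ F, primeDivisorIdeal ζ) ≠ ⊤ := by
    intro htop
    rw [htop] at hM
    exact absurd hM (by simp)
  -- `h0 (P²) ≠ ⊤`: `V(P²)` has support `⋃ cl{ζ}`, over the closed point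
  have hfinP2 : h0 π ((∏ ζ ∈ F, primeDivisorIdeal ζ) ^ 2) ≠ ⊤ := by
    refine h0_ne_top_of_base_eq_closedPoint π ((∏ ζ ∈ F, primeDivisorIdeal ζ) ^ 2) fun x => ?_
    have hmem : ((∏ ζ ∈ F, primeDivisorIdeal ζ) ^ 2).subschemeι.base x ∈
        ((((∏ ζ ∈ F, primeDivisorIdeal ζ) ^ 2).support : Set X)) :=
      (Set.ext_iff.mp (Scheme.IdealSheafData.range_subschemeι (I := (∏ ζ ∈ F, primeDivisorIdeal ζ) ^ 2)) _).mp
        (Set.mem_range_self x)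
    rw [Scheme.IdealSheafData.support_pow _ 2 two_ne_zero] at hmem
    obtain ⟨ζ, hζ, hsp⟩ := (mem_support_finset_prod_primeDivisorIdeal_iff F _).mp hmem
    change π.base _ = closedPoint S
    exact base_eq_closedPoint_of_specializes π (hFe ζ hζ).1 hsp
  -- pass to `ℕ`, then `ℤ`
  obtain ⟨p, hp⟩ := ENat.ne_top_iff_exists.mp hfinP
  obtain ⟨q, hq⟩ := ENat.ne_top_iff_exists.mp hfinP2
  obtain ⟨a₀, ha₀⟩ := ENat.ne_top_iff_exists.mp hfin1
  obtain ⟨b₀, hb₀⟩ := ENat.ne_top_iff_exists.mp hfin2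
  have hMN : 3 * p < q := by
    rw [← hp, ← hq] at hM
    exact_mod_cast hM
  have hMZ : 3 * ((h0 π (∏ ζ ∈ F, primeDivisorIdeal ζ)).toNat : ℤ) <
      ((h0 π ((∏ ζ ∈ F, primeDivisorIdeal ζ) ^ 2)).toNat : ℤ) := by
    rw [← hp, ← hq, ENat.toNat_coe, ENat.toNat_coe]
    exact_mod_cast hMN
  have hlt := sum_beta_self_lt π h2 hS hπ h131b h131d F hF hFe hMZ
  -- symmetry: all terms equal the `ζ₀` term
  have hsq : ∀ ζ ∈ F, h0 π (primeDivisorIdeal ζ * primeDivisorIdeal ζ) = h0 π (primeDivisorIdeal ζ₀ ^ 2) :=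
    fun ζ hζ => by rw [← pow_two]; exact hb ζ hζ
  have hs1 : ∑ ζ ∈ F, (((h0 π (primeDivisorIdeal ζ)).toNat : ℤ) + ((h0 π (primeDivisorIdeal ζ)).toNat : ℤ) -
        ((h0 π (primeDivisorIdeal ζ * primeDivisorIdeal ζ)).toNat : ℤ)) =
      F.card * ((a₀ : ℤ) + a₀ - b₀) := by
    rw [Finset.sum_congr rfl fun ζ hζ => show (((h0 π (primeDivisorIdeal ζ)).toNat : ℤ) +
        ((h0 π (primeDivisorIdeal ζ)).toNat : ℤ) - ((h0 π (primeDivisorIdeal ζ * primeDivisorIdeal ζ)).toNat : ℤ)) =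
        (a₀ : ℤ) + a₀ - b₀ by rw [ha ζ hζ, hsq ζ hζ, ← ha₀, ← hb₀, ENat.toNat_coe, ENat.toNat_coe],
      Finset.sum_const, nsmul_eq_mul]
  have hs2 : ∑ ζ ∈ F, ((h0 π (primeDivisorIdeal ζ)).toNat : ℤ) = F.card * (a₀ : ℤ) := by
    rw [Finset.sum_congr rfl fun ζ hζ => show ((h0 π (primeDivisorIdeal ζ)).toNat : ℤ) = a₀ by
        rw [ha ζ hζ, ← ha₀, ENat.toNat_coe], Finset.sum_const, nsmul_eq_mul]
  rw [hs1, hs2] at hlt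
  have hr : (0 : ℤ) < F.card := by exact_mod_cast Finset.card_pos.mpr hF
  -- `r · β₀ < −r · a₀` gives `β₀ < −a₀`, i.e. `3 a₀ < b₀`
  have hβ : (a₀ : ℤ) + a₀ - b₀ < -(a₀ : ℤ) := by
    by_contra hge
    push Not at hge
    have := mul_le_mul_of_nonneg_left hge hr.le
    linarith
  have hN : 3 * a₀ < b₀ := by
    have hZ : 3 * (a₀ : ℤ) < b₀ := by linarith
    exact_mod_cast hZ
  rw [← ha₀, ← hb₀]
  exact_mod_cast hN

end Numerics

end Summit.ResolutionOfSingularities.ResolutionOfSingularities.Theorems.NoZeno.ExcCount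

end
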